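/-
Copyright: rh-split cell, seat prover-l1 (L1/L19 «DUST WALL»), 2026-08-27.  Plane topology.
Nothing here bears on the truth of RH.
-/
import Summits.RiemannHypothesis.RiemannHypothesis.Theorems.Splittings.ScrewDustZorettiMoat
import Literature.Topology.PlaneTopology.Janiszewski
import HarnessLib

/-!
# Zoretti hulls: small wall-free grid cycles in the origin's component around a point-component pole

Plane-topology core of the crux `PointComponentInvisible` (route `ScrewDustWall`, X-11 «DUST WALL»,
stmt-RiemannHypothesis-21690).  Let `W ⊆ ℂ` be closed with `0 ∉ W`, `p ∈ W ∩ 𝔻` a POINT-COMPONENT of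
`W ∩ 𝔻`, ADHERENT to the component `Ω₀` of `0` in `𝔻 ∖ W`, and `T ∋ p` a countable set (the poles).
Then (`exists_small_cellComplex`) for every `ε > 0` there is a uniform grid none of whose lines meets
`T` and a finite complex `H` of its cells inside `ball p ε`, one of whose open cells contains `p`, all of
whose EXPOSED edges lie in `Ω₀` — exactly the input of `ScrewDust.false_of_small_cellComplexes`.

Construction (`exists_piece_and_path`, grid of mesh `δ ≪ min ρ d₀` avoiding `T`): `A` = union of
the closed cells meeting the piece `P` (compact), `B = (W ∖ P) ∩ closedBall 0 1 ∪ sphere 0 1` (compact,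
`A ∩ B = ∅`), `C₀` / `C_A` = components of `0` in `ℂ ∖ (A ∪ B)` / `ℂ ∖ A`;
`H = {cells meeting P} ∪ {cells whose open cell misses C₀ and whose centre is not in C_A}` inside
`ball p ε`.  If a cell of `H` touches a cell `Q' ∉ H` then `Q' ⊆ Ω₀`; the one non-elementary input is
JANISZEWSKI's theorem (tree): a point of `N` joined to `0` off `A` is joined to `0` off `A ∪ B`.

No `sorry`, no new axioms, no definitions, no instances, no notation.
-/

set_option linter.dupNamespace false

namespace Summit.RiemannHypothesis.RiemannHypothesis.Theorems.Splittings.ScrewDust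

open Complex Filter Topology Set Metric
open Summit.RiemannHypothesis.RiemannHypothesis.Theorems.Splittings.ScrewBorelFlux
open Literature.Topology.PlaneTopology

/-- **Zoretti hull (small wall-free grid cycles in `Ω₀`).**  See the module docstring. -/
theorem exists_small_cellComplex {W T : Set ℂ} (hW : IsClosed W) (h0W : (0 : ℂ) ∉ W)
    (hT : T.Countable) {p : ℂ} (hpW : p ∈ W) (hp1 : ‖p‖ < 1) (hpT : p ∈ T)
    (hcomp : connectedComponentIn (W ∩ ball (0 : ℂ) 1) p ⊆ {p})
    (hadh : p ∈ closure (connectedComponentIn (ball (0 : ℂ) 1 \ W) 0)) {ε : ℝ} (hε : 0 < ε) :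
    ∃ (x y : ℤ → ℝ) (H : Finset (ℤ × ℤ)),
      (∀ m, x m ≤ x (m + 1)) ∧ (∀ n, y n ≤ y (n + 1)) ∧
      (∃ k ∈ H, p ∈ Ioo (x k.1) (x (k.1 + 1)) ×ℂ Ioo (y k.2) (y (k.2 + 1))) ∧
      (∀ k ∈ H, Icc (x k.1) (x (k.1 + 1)) ×ℂ Icc (y k.2) (y (k.2 + 1)) ⊆ ball p ε) ∧
      (∀ q ∈ T, ∀ k ∈ H, q ∈ Ioo (x k.1) (x (k.1 + 1)) ×ℂ Ioo (y k.2) (y (k.2 + 1)) ∨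
          q ∉ Icc (x k.1) (x (k.1 + 1)) ×ℂ Icc (y k.2) (y (k.2 + 1))) ∧
      (∀ k ∈ H, (k.1, k.2 - 1) ∉ H → (fun t : ℝ ↦ (t : ℂ) + y k.2 * I) '' Icc (x k.1) (x (k.1 + 1)) ⊆
        connectedComponentIn (ball (0 : ℂ) 1 \ W) 0) ∧
      (∀ k ∈ H, (k.1, k.2 + 1) ∉ H →
        (fun t : ℝ ↦ (t : ℂ) + y (k.2 + 1) * I) '' Icc (x k.1) (x (k.1 + 1)) ⊆
          connectedComponentIn (ball (0 : ℂ) 1 \ W) 0) ∧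
      (∀ k ∈ H, (k.1 - 1, k.2) ∉ H → (fun t : ℝ ↦ (x k.1 : ℂ) + t * I) '' Icc (y k.2) (y (k.2 + 1)) ⊆
        connectedComponentIn (ball (0 : ℂ) 1 \ W) 0) ∧
      (∀ k ∈ H, (k.1 + 1, k.2) ∉ H →
        (fun t : ℝ ↦ (x (k.1 + 1) : ℂ) + t * I) '' Icc (y k.2) (y (k.2 + 1)) ⊆
          connectedComponentIn (ball (0 : ℂ) 1 \ W) 0) := by
  classical
  -- 0. sizes
  have hp0 : p ≠ 0 := fun h ↦ h0W (h ▸ hpW)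
  have hpn : 0 < ‖p‖ := norm_pos_iff.2 hp0
  set ε' : ℝ := min ε (min ((1 - ‖p‖) / 2) (‖p‖ / 2)) with hε'
  have hε'0 : 0 < ε' := lt_min hε (lt_min (by linarith) (by linarith))
  have hε'ε : ε' ≤ ε := min_le_left _ _
  have hε'1 : ε' < 1 - ‖p‖ := (min_le_right _ _).trans_lt ((min_le_left _ _).trans_lt (by linarith))
  have hε'p : ε' ≤ ‖p‖ / 2 := (min_le_right _ _).trans (min_le_right _ _)
  set Ω₀ : Set ℂ := connectedComponentIn (ball (0 : ℂ) 1 \ W) 0 with hΩ₀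
  have hRo : IsOpen (ball (0 : ℂ) 1 \ W) := isOpen_ball.sdiff hW
  have hΩsub : Ω₀ ⊆ ball 0 1 \ W := connectedComponentIn_subset _ _
  have hball1 : ball p ε' ⊆ ball (0 : ℂ) 1 := fun z hz ↦ by
    rw [mem_ball, dist_eq_norm] at hz
    rw [mem_ball_zero_iff]
    calc ‖z‖ = ‖p + (z - p)‖ := by congr 1; ring
      _ ≤ ‖p‖ + ‖z - p‖ := norm_add_le _ _
      _ < 1 := by linarith
  -- 1–2. the clopen piece with its moat and neighbourhood; a point of `Ω₀` near `p` and a path to it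
  obtain ⟨P, N, K, ρ, d₀, w₀, hρ0, hρε, hPW, hpP, hPε, hWP, hgap, hNc, hNε, hNW, hballN, hw₀B, hd₀,
    hKpc, h0K, hw₀K, hKΩ, hsep₀⟩ := exists_piece_and_path hW h0W hpW hcomp hadh hε'0 hε'1
  -- 3. the mesh and the grid
  set δ : ℝ := min (ρ / 20) (d₀ / 4) with hδ
  have hδ0 : 0 < δ := lt_min (by linarith) (by linarith)
  have hδρ : 20 * δ ≤ ρ := by have := min_le_left (ρ / 20) (d₀ / 4); linarith
  have hδd : 4 * δ ≤ d₀ := by have := min_le_right (ρ / 20) (d₀ / 4); linarith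
  have hδε : 80 * δ ≤ ε' := by linarith
  obtain ⟨a₁, a₂, ha₁, ha₂⟩ := exists_grid_avoiding hT δ
  obtain ⟨x, hx⟩ : ∃ x : ℤ → ℝ, ∀ m, x m = a₁ + δ * m := ⟨_, fun m ↦ rfl⟩
  obtain ⟨y, hy⟩ : ∃ y : ℤ → ℝ, ∀ n, y n = a₂ + δ * n := ⟨_, fun n ↦ rfl⟩
  obtain ⟨cell, cello, ctr, hcell, hcello, hoc, hctro, hctrc, hdiam', hconv, hconvo, hmemfloor, huniq',
    hclos⟩ := exists_grid_package hx hy hδ0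
  have hdiam : ∀ {k : ℤ × ℤ} {v w : ℂ}, v ∈ cell k → w ∈ cell k → dist v w ≤ 2 * δ :=
    fun {k v w} hv hw ↦ hdiam' k v hv w hw
  have huniq : ∀ {v : ℂ} {k j : ℤ × ℤ}, v ∈ cello k → v ∈ cell j → j = k :=
    fun {v k j} hv hj ↦ huniq' v k j hv hj
  -- 4. the finite box of relevant cells
  set Box : Finset (ℤ × ℤ) := (Finset.Icc (⌊(p.re - ε' - a₁) / δ⌋ - 1) ⌈(p.re + ε' - a₁) / δ⌉) ×ˢ
    (Finset.Icc (⌊(p.im - ε' - a₂) / δ⌋ - 1) ⌈(p.im + ε' - a₂) / δ⌉) with hBoxdef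
  have hBox : ∀ k : ℤ × ℤ, ∀ z ∈ cell k, dist z p ≤ ε' → k ∈ Box := fun k z hz hzp ↦ by
    rw [hcell] at hz
    exact mem_box_of_mem_cell hx hy hδ0 hz hzp
  -- 5. the near cells `A`, the far obstacle `B`, the components `C₀ ⊆ Ω₀` and `C_A`
  set Ncl : Finset (ℤ × ℤ) := Box.filter (fun k ↦ (cell k ∩ P).Nonempty) with hNcl
  set A : Set ℂ := ⋃ k ∈ Ncl, cell k with hA
  have hAc : IsCompact A := Ncl.isCompact_biUnion fun k _ ↦ by
    rw [hcell]; exact isCompact_Icc.reProdIm isCompact_Icc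
  have hmemNcl : ∀ {k : ℤ × ℤ} {v : ℂ}, v ∈ cell k → v ∈ P → k ∈ Ncl := fun {k v} hv hvP ↦
    Finset.mem_filter.2 ⟨hBox k v hv (by have := mem_ball.1 (hPε hvP); linarith), ⟨v, hv, hvP⟩⟩
  have hPA : P ⊆ A := fun v hvP ↦
    mem_iUnion₂.2 ⟨_, hmemNcl (hmemfloor v) hvP, hmemfloor v⟩
  have hAP : ∀ z ∈ A, ∃ w ∈ P, dist z w ≤ 2 * δ := fun z hz ↦ by
    obtain ⟨k, hk, hzk⟩ := mem_iUnion₂.1 hz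
    obtain ⟨w, hwk, hwP⟩ := (Finset.mem_filter.1 hk).2
    exact ⟨w, hwP, hdiam hzk hwk⟩
  set rA : ℝ := ε' / 4 + 2 * δ with hrA
  have hArA : ∀ z ∈ A, dist z p ≤ rA := fun z hz ↦ by
    obtain ⟨w, hwP, hzw⟩ := hAP z hz
    have := mem_ball.1 (hPε hwP)
    linarith [dist_triangle z w p]
  have hrAp : rA < ‖p‖ := by linarith
  have hA1 : A ⊆ ball (0 : ℂ) 1 := fun z hz ↦ hball1 (mem_ball.2 (by linarith [hArA z hz]))
  set B : Set ℂ := ((W \ P) ∩ closedBall (0 : ℂ) 1) ∪ sphere (0 : ℂ) 1 with hB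
  have hBc : IsCompact B := (isCompact_closedBall (0 : ℂ) 1).of_isClosed_subset
    ((hWP.inter isClosed_closedBall).union isClosed_sphere)
    (union_subset inter_subset_right sphere_subset_closedBall)
  have hAB : Disjoint A B := by
    refine Set.disjoint_left.2 fun z hzA hzB ↦ ?_
    rcases hzB with ⟨hzW, -⟩ | hzS
    · obtain ⟨w, hwP, hzw⟩ := hAP z hzA
      have := hgap w hwP z hzW
      rw [dist_comm] at this
      linarith
    · have := hA1 hzA
      rw [mem_ball_zero_iff] at this
      rw [mem_sphere_zero_iff_norm] at hzS
      linarith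
  set C₀ : Set ℂ := connectedComponentIn (A ∪ B)ᶜ 0 with hC₀
  set CA : Set ℂ := connectedComponentIn Aᶜ 0 with hCA
  have h0A : (0 : ℂ) ∉ A := fun h ↦ by have := hArA 0 h; rw [dist_zero_left] at this; linarith
  have h0B : (0 : ℂ) ∉ B := by
    rintro (⟨⟨h, -⟩, -⟩ | h)
    · exact h0W h
    · rw [mem_sphere_zero_iff_norm, norm_zero] at h; exact zero_ne_one h
  have h0AB : (0 : ℂ) ∈ (A ∪ B)ᶜ := fun h ↦ h.elim h0A h0B
  have hC₀sub : C₀ ⊆ (A ∪ B)ᶜ := connectedComponentIn_subset _ _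
  have hC₀ball : C₀ ⊆ ball (0 : ℂ) 1 := subset_ball_of_disjoint_sphere isPreconnected_connectedComponentIn
    (mem_connectedComponentIn h0AB) fun z hz h ↦ hC₀sub hz (Or.inr (Or.inr h))
  have hC₀Ω : C₀ ⊆ Ω₀ := by
    refine isPreconnected_connectedComponentIn.subset_connectedComponentIn
      (mem_connectedComponentIn h0AB) fun z hz ↦ ⟨hC₀ball hz, fun hzW ↦ ?_⟩
    by_cases hzP : z ∈ P
    · exact hC₀sub hz (Or.inl (hPA hzP))
    · exact hC₀sub hz (Or.inr (Or.inl ⟨⟨hzW, hzP⟩, ball_subset_closedBall (hC₀ball hz)⟩))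
  have hw₀C : w₀ ∈ C₀ := by
    refine hKpc.subset_connectedComponentIn h0K (fun z hzK ↦ ?_) hw₀K
    have hzΩ := hΩsub (hKΩ hzK)
    rintro (hA' | (⟨⟨hW', -⟩, -⟩ | hS))
    · obtain ⟨w, hwP, hzw⟩ := hAP _ hA'
      have := hsep₀ _ hzK w (hPW hwP)
      rw [← dist_eq_norm, dist_comm] at this
      linarith
    · exact hzΩ.2 hW'
    · have := hzΩ.1
      rw [mem_ball_zero_iff] at this
      rw [mem_sphere_zero_iff_norm] at hS
      linarith
  have hC₀A : C₀ ⊆ CA := connectedComponentIn_mono 0 (compl_subset_compl.2 subset_union_left)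
  have hNB : N ⊆ Bᶜ := by
    rintro z hzN (⟨⟨hzW, hzP⟩, -⟩ | hzS)
    · exact hzP (hNW ⟨hzN, hzW⟩)
    · have := hball1 (hNε hzN)
      rw [mem_ball_zero_iff] at this
      rw [mem_sphere_zero_iff_norm] at hzS
      linarith
  have hw₀N : w₀ ∈ N := hballN p hpP hw₀B
  have hNCB : N ⊆ connectedComponentIn Bᶜ 0 := by
    have h1 : w₀ ∈ connectedComponentIn Bᶜ 0 :=
      connectedComponentIn_mono 0 (compl_subset_compl.2 subset_union_right) hw₀C
    rw [connectedComponentIn_eq h1]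
    exact hNc.subset_connectedComponentIn hw₀N hNB
  have hJan : ∀ z ∈ N, z ∈ CA → z ∈ C₀ := fun z hzN hzA ↦
    janiszewski hAc hBc (by rw [Set.disjoint_iff_inter_eq_empty.1 hAB]; exact isPreconnected_empty)
      hzA (hNCB hzN)
  have hfar : ∀ z : ℂ, rA < dist z p → z ∈ CA := by
    intro z hz
    have hE : {v : ℂ | rA < dist v p} ⊆ Aᶜ := fun v hv hvA ↦ by
      have := hArA v hvA; exact absurd hv (not_lt.2 this)
    have h0E : (0 : ℂ) ∈ {v : ℂ | rA < dist v p} := by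
      rw [mem_setOf_eq, dist_zero_left]; exact hrAp
    exact (isConnected_setOf_lt_dist p (by positivity)).isPreconnected.subset_connectedComponentIn
      h0E hE hz
  have hΩcl : ∀ z ∈ closure Ω₀, z ∈ ball (0 : ℂ) 1 → z ∉ W → z ∈ Ω₀ := fun z hz hz1 hzW ↦
    mem_connectedComponentIn_of_mem_closure hRo hz ⟨hz1, hzW⟩
  -- 6. the complex
  set H : Finset (ℤ × ℤ) := Box.filter (fun k ↦ cell k ⊆ ball p ε' ∧
    (k ∈ Ncl ∨ (cello k ∩ C₀ = ∅ ∧ ctr k ∉ CA))) with hHdef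
  -- 7. THE CORE: a cell outside `H` touching a cell of `H` lies in `Ω₀`
  have core : ∀ k ∈ H, ∀ k' : ℤ × ℤ, k' ∉ H → ∀ z : ℂ, z ∈ cell k → z ∈ cell k' →
      cell k' ⊆ Ω₀ := by
    intro k hk k' hk' z hzk hzk'
    obtain ⟨-, hkball, hkalt⟩ := Finset.mem_filter.1 hk
    have hUconn : IsPreconnected (cell k ∪ cell k') := (hconv k).union z hzk hzk' (hconv k')
    by_cases hR : cell k' ⊆ ball p ε'
    · have hk'Box : k' ∈ Box := hBox k' z hzk' (mem_ball.1 (hR hzk')).le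
      have hk'N : k' ∉ Ncl ∧ ((cello k' ∩ C₀).Nonempty ∨ ctr k' ∈ CA) := by
        have h1 : ¬ (k' ∈ Ncl ∨ (cello k' ∩ C₀ = ∅ ∧ ctr k' ∉ CA)) :=
          fun h ↦ hk' (Finset.mem_filter.2 ⟨hk'Box, hR, h⟩)
        push Not at h1
        refine ⟨h1.1, ?_⟩
        by_cases h2 : (cello k' ∩ C₀).Nonempty
        · exact Or.inl h2
        · exact Or.inr (h1.2 (Set.not_nonempty_iff_eq_empty.1 h2))
      have hk'P : ∀ v ∈ cell k', v ∉ P := fun v hv hvP ↦ hk'N.1 (hmemNcl hv hvP)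
      by_cases hF : (cello k' ∩ C₀).Nonempty
      · obtain ⟨w, hwk', hwC⟩ := hF
        by_cases hF1 : ∀ v ∈ cell k', v ∉ W \ P
        · -- the free case: the open cell lies in `C₀`, the closed cell in `Ω₀`
          have hWfree : ∀ v ∈ cell k', v ∉ W := fun v hv hvW ↦ by
            by_cases hvP : v ∈ P
            · exact hk'P v hv hvP
            · exact hF1 v hv ⟨hvW, hvP⟩
          have hcellosub : cello k' ⊆ (A ∪ B)ᶜ := by
            rintro v hv (hvA | (⟨⟨hvW, -⟩, -⟩ | hvS))
            · obtain ⟨j, hj, hvj⟩ := mem_iUnion₂.1 hvA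
              have := huniq hv hvj
              exact hk'N.1 (this ▸ hj)
            · exact hWfree v (hoc k' hv) hvW
            · have hv1 := hball1 (hR (hoc k' hv))
              rw [mem_ball_zero_iff] at hv1
              rw [mem_sphere_zero_iff_norm] at hvS
              linarith
          have hcelloC : cello k' ⊆ C₀ := by
            rw [hC₀, connectedComponentIn_eq hwC]
            exact (hconvo k').subset_connectedComponentIn hwk' hcellosub
          intro v hv
          exact hΩcl v (closure_mono (hcelloC.trans hC₀Ω) (hclos k' hv))
            (hball1 (hR hv)) (hWfree v hv)
        · -- the far-wall case: impossible
          exfalso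
          push Not at hF1
          obtain ⟨z', hz'k', hz'W⟩ := hF1
          have hfarP' : ∀ v ∈ cell k', ∀ w ∈ P, ρ - 2 * δ ≤ dist v w := fun v hv w hw ↦ by
            have h1 := hgap w hw z' hz'W
            have h2 := hdiam hv hz'k'
            linarith [dist_triangle w v z', dist_comm w v]
          have hfarP : ∀ v ∈ cell k, ∀ w ∈ P, ρ - 4 * δ ≤ dist v w := fun v hv w hw ↦ by
            have h1 := hfarP' z hzk' w hw
            have h2 := hdiam hv hzk
            linarith [dist_triangle z v w, dist_comm z v]
          have hkN : k ∉ Ncl := fun hkN ↦ by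
            obtain ⟨v, hv, hvP⟩ := (Finset.mem_filter.1 hkN).2
            have := hfarP v hv v hvP
            rw [dist_self] at this
            linarith
          obtain ⟨-, hkctr⟩ := hkalt.resolve_left hkN
          have hkA : ∀ v ∈ cell k, v ∉ A := fun v hv hvA ↦ by
            obtain ⟨w, hw, hvw⟩ := hAP v hvA
            have := hfarP v hv w hw
            linarith
          have hk'A : ∀ v ∈ cell k', v ∉ A := fun v hv hvA ↦ by
            obtain ⟨w, hw, hvw⟩ := hAP v hvA
            have := hfarP' v hv w hw
            linarith
          have hUsub : cell k ∪ cell k' ⊆ Aᶜ := fun v hv ↦ hv.elim (hkA v) (hk'A v)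
          have hwCA : w ∈ CA := hC₀A hwC
          have : ctr k ∈ CA := by
            rw [hCA, connectedComponentIn_eq hwCA]
            exact hUconn.subset_connectedComponentIn (Or.inr (hoc k' hwk')) hUsub
              (Or.inl (hctrc k))
          exact hkctr this
      · -- the enclosed case: impossible
        exfalso
        have hG : ctr k' ∈ CA := hk'N.2.resolve_left hF
        have hk'C : cello k' ∩ C₀ = ∅ := Set.not_nonempty_iff_eq_empty.1 hF
        by_cases hG1 : (∃ v ∈ cell k, v ∈ A) ∨ (∃ v ∈ cell k', v ∈ A)
        · have hctrN : ctr k' ∈ N := by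
            rcases hG1 with ⟨v, hv, hvA⟩ | ⟨v, hv, hvA⟩
            · obtain ⟨w, hw, hvw⟩ := hAP v hvA
              refine hballN w hw (mem_ball.2 ?_)
              calc dist (ctr k') w ≤ dist (ctr k') z + dist z v + dist v w := dist_triangle4 _ _ _ _
                _ ≤ 2 * δ + 2 * δ + 2 * δ := by
                    gcongr
                    · exact hdiam (hctrc k') hzk'
                    · exact hdiam hzk hv
                _ < ρ := by linarith
            · obtain ⟨w, hw, hvw⟩ := hAP v hvA
              refine hballN w hw (mem_ball.2 ?_)
              calc dist (ctr k') w ≤ dist (ctr k') v + dist v w := dist_triangle _ _ _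
                _ ≤ 2 * δ + 2 * δ := by
                    gcongr
                    exact hdiam (hctrc k') hv
                _ < ρ := by linarith
          have h1 := hJan _ hctrN hG
          have h2 : ctr k' ∈ cello k' ∩ C₀ := ⟨hctro k', h1⟩
          rw [hk'C] at h2
          exact h2
        · push Not at hG1
          obtain ⟨hkA, hk'A⟩ := hG1
          have hkN : k ∉ Ncl := fun hkN ↦ hkA z hzk (mem_iUnion₂.2 ⟨k, hkN, hzk⟩)
          obtain ⟨-, hkctr⟩ := hkalt.resolve_left hkN
          have hUsub : cell k ∪ cell k' ⊆ Aᶜ := fun v hv ↦ hv.elim (hkA v) (hk'A v)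
          have : ctr k ∈ CA := by
            rw [hCA, connectedComponentIn_eq hG]
            exact hUconn.subset_connectedComponentIn (Or.inr (hctrc k')) hUsub (Or.inl (hctrc k))
          exact hkctr this
    · -- the rim case: impossible
      exfalso
      obtain ⟨w', hw'k', hw'⟩ := not_subset.1 hR
      have h1 : ε' ≤ dist w' p := not_lt.1 fun h ↦ hw' (mem_ball.2 h)
      have h2 := hdiam hw'k' hzk'
      have hzp : ε' - 2 * δ ≤ dist z p := by linarith [dist_triangle w' z p]
      have h3 := hdiam hzk (hctrc k)
      have hctrfar : rA < dist (ctr k) p := by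
        have := dist_triangle z (ctr k) p
        rw [hrA]; linarith
      have hctrCA : ctr k ∈ CA := hfar _ hctrfar
      have hkN : k ∉ Ncl := fun hkN ↦ by
        obtain ⟨v, hv, hvP⟩ := (Finset.mem_filter.1 hkN).2
        have h4 : dist v p < ε' / 4 := mem_ball.1 (hPε hvP)
        have h5 := hdiam hzk hv
        linarith [dist_triangle z v p]
      exact (hkalt.resolve_left hkN).2 hctrCA
  -- 8. the outputs
  have hmono : ∀ m, x m ≤ x (m + 1) := grid_le_succ hx hδ0.le
  have hmono' : ∀ n, y n ≤ y (n + 1) := grid_le_succ hy hδ0.le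
  refine ⟨x, y, H, hmono, hmono', ?_, ?_, ?_, ?_, ?_, ?_, ?_⟩
  · -- `p` lies in an open cell of `H`
    have hpk := hmemfloor p
    have hxl : ∀ m, p.re ≠ x m := fun m ↦ by rw [hx]; exact ha₁ p hpT m
    have hyl : ∀ n, p.im ≠ y n := fun n ↦ by rw [hy]; exact ha₂ p hpT n
    have hpko := (mem_cello_of_not_mem_lines hxl hyl (⌊(p.re - a₁) / δ⌋, ⌊(p.im - a₂) / δ⌋)).resolve_right
      (fun h ↦ h (by rw [← hcell]; exact hpk))
    refine ⟨_, Finset.mem_filter.2 ⟨hBox _ p hpk (by rw [dist_self]; exact hε'0.le), ?_,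
      Or.inl (hmemNcl hpk hpP)⟩, hpko⟩
    intro v hv
    rw [mem_ball]
    have := hdiam hv hpk
    linarith
  · -- cells of `H` are small
    intro k hk
    rw [← hcell]
    exact (Finset.mem_filter.1 hk).2.1.trans (ball_subset_ball hε'ε)
  · -- poles are off the grid lines
    intro q hq k _
    exact mem_cello_of_not_mem_lines (fun m ↦ by rw [hx]; exact ha₁ q hq m)
      (fun n ↦ by rw [hy]; exact ha₂ q hq n) k
  · -- exposed bottom edges
    intro k hk hk'
    rintro _ ⟨t, ht, rfl⟩
    have hre : ((t : ℂ) + y k.2 * I).re = t := by simp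
    have him : ((t : ℂ) + y k.2 * I).im = y k.2 := by simp
    have h1 : ((t : ℂ) + y k.2 * I) ∈ cell k := by
      rw [hcell, mem_reProdIm, hre, him]
      exact ⟨ht, le_rfl, hmono' _⟩
    have h2 : ((t : ℂ) + y k.2 * I) ∈ cell (k.1, k.2 - 1) := by
      rw [hcell, mem_reProdIm, hre, him]
      simp only [sub_add_cancel]
      exact ⟨ht, by have := hmono' (k.2 - 1); rwa [sub_add_cancel] at this, le_rfl⟩
    exact core k hk _ hk' _ h1 h2 h2
  · -- exposed top edges
    intro k hk hk'
    rintro _ ⟨t, ht, rfl⟩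
    have hre : ((t : ℂ) + y (k.2 + 1) * I).re = t := by simp
    have him : ((t : ℂ) + y (k.2 + 1) * I).im = y (k.2 + 1) := by simp
    have h1 : ((t : ℂ) + y (k.2 + 1) * I) ∈ cell k := by
      rw [hcell, mem_reProdIm, hre, him]
      exact ⟨ht, hmono' _, le_rfl⟩
    have h2 : ((t : ℂ) + y (k.2 + 1) * I) ∈ cell (k.1, k.2 + 1) := by
      rw [hcell, mem_reProdIm, hre, him]
      exact ⟨ht, le_rfl, hmono' _⟩
    exact core k hk _ hk' _ h1 h2 h2
  · -- exposed left edges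
    intro k hk hk'
    rintro _ ⟨t, ht, rfl⟩
    have hre : ((x k.1 : ℂ) + t * I).re = x k.1 := by simp
    have him : ((x k.1 : ℂ) + t * I).im = t := by simp
    have h1 : ((x k.1 : ℂ) + t * I) ∈ cell k := by
      rw [hcell, mem_reProdIm, hre, him]
      exact ⟨⟨le_rfl, hmono _⟩, ht⟩
    have h2 : ((x k.1 : ℂ) + t * I) ∈ cell (k.1 - 1, k.2) := by
      rw [hcell, mem_reProdIm, hre, him]
      simp only [sub_add_cancel]
      exact ⟨⟨by have := hmono (k.1 - 1); rwa [sub_add_cancel] at this, le_rfl⟩, ht⟩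
    exact core k hk _ hk' _ h1 h2 h2
  · -- exposed right edges
    intro k hk hk'
    rintro _ ⟨t, ht, rfl⟩
    have hre : ((x (k.1 + 1) : ℂ) + t * I).re = x (k.1 + 1) := by simp
    have him : ((x (k.1 + 1) : ℂ) + t * I).im = t := by simp
    have h1 : ((x (k.1 + 1) : ℂ) + t * I) ∈ cell k := by
      rw [hcell, mem_reProdIm, hre, him]
      exact ⟨⟨hmono _, le_rfl⟩, ht⟩
    have h2 : ((x (k.1 + 1) : ℂ) + t * I) ∈ cell (k.1 + 1, k.2) := by
      rw [hcell, mem_reProdIm, hre, him]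
      exact ⟨⟨le_rfl, hmono _⟩, ht⟩
    exact core k hk _ hk' _ h1 h2 h2

end Summit.RiemannHypothesis.RiemannHypothesis.Theorems.Splittings.ScrewDust
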